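import Literature.Computability.Complexity.HardcoreInapproximabilitySecondMomentFormula
import HarnessLib

/-!
# The ε-form of the two-rectangle permutation count (Sly's inner sum of (e:gt2Moment))

The exact second moment of Sly's conditional partition functions (`sly_secondMoment_count`, file
`HardcoreInapproximabilitySecondMomentFormula`) is expressed through `pairAvoidSum`, the number of
permutations of `N` points avoiding two rectangles, written as a sum over `16`-cell class-incidence
tables. Here that table sum is reduced to a single sum:

* `eq_epsTable_of_admissible` — an admissible table is determined by two cells `(e, f)`
  (`epsTable`), and `pairAvoidSum_eq_sum_epsIndex` re-indexes the table sum by the admissible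
  `(e, f)` (`epsIndex`);
* `pairAvoidTermN_epsTable` — the value of an `(e,f)`-term, `sum_inner_vandermonde` — the `f`-sum is a
  Vandermonde convolution, whence
* `pairAvoidSum_pairSizes_eq` — **`#{π : π(A₁)∩B₁ = ∅, π(A₂)∩B₂ = ∅} =
  g!(P!)²R!·C(F₀,g)·Σ_e C(F₀-g,e)C(A,P-e)C(N-b-g-e,P)`** (`P = a-g`, `A = b-h`, `R = N-2a+g`,
  `F₀ = N-2b+h`), Sly's three-event form.

## References
* [Sly2010] A. Sly, *Computational transition at the uniqueness threshold*, FOCS 2010 /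
  arXiv:1005.5584, §3.2 (proof of Lemma 3.5, eq. (e:gt2Moment)).
* [MosselWeitzWormald2008] E. Mossel, D. Weitz, N. Wormald, *On the hardness of sampling independent
  sets beyond the tree threshold*, PTRF 143 (2009), §5 (the three events defining `Ψ₂`).
-/

namespace Literature.Computability.Complexity

open Finset

section BoolPairs

/-- Sums over the four pair-classes. [folklore] -/
theorem sum_boolPair {M : Type*} [AddCommMonoid M] (F : Bool × Bool → M) :
    ∑ i, F i = F (true, true) + F (true, false) + (F (false, true) + F (false, false)) := by
  rw [Fintype.sum_prod_type]
  simp only [Fintype.sum_bool]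

/-- Products over the four pair-classes. [folklore] -/
theorem prod_boolPair {M : Type*} [CommMonoid M] (F : Bool × Bool → M) :
    ∏ i, F i = F (true, true) * F (true, false) * (F (false, true) * F (false, false)) := by
  rw [Fintype.prod_prod_type]
  simp only [Fintype.prod_bool]

/-- The universe of pair-classes as an explicit `insert` chain. [folklore] -/
theorem univ_boolPair :
    (univ : Finset (Bool × Bool)) =
      insert (true, true) (insert (true, false) (insert (false, true) {(false, false)})) := by
  decide

/-- **The multinomial coefficient of a row of four cells** as a product of binomials. [folklore] -/
theorem multinomial_boolPair (f : Bool × Bool → ℕ) :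
    Nat.multinomial univ f =
      (f (true, true) + (f (true, false) + (f (false, true) + f (false, false)))).choose
          (f (true, true)) *
        ((f (true, false) + (f (false, true) + f (false, false))).choose (f (true, false)) *
          ((f (false, true) + f (false, false)).choose (f (false, true)))) := by
  rw [univ_boolPair, Nat.multinomial_insert (by decide), Nat.multinomial_insert (by decide),
    Nat.multinomial_insert (by decide), Nat.multinomial_singleton]
  simp only [sum_insert (show (true, false) ∉ insert (false, true) ({(false, false)} :
      Finset (Bool × Bool)) by decide),
    sum_insert (show (false, true) ∉ ({(false, false)} : Finset (Bool × Bool)) by decide),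
    sum_singleton, mul_one]

end BoolPairs

section EpsTable

/-- **The `(e, f)`-table**: the unique class-incidence matrix of a permutation avoiding the two
rectangles `(A₁,B₁), (A₂,B₂)` (`|A₁| = |A₂| = a`, `|A₁ ∩ A₂| = g`, `|B₁| = |B₂| = b`,
`|B₁ ∩ B₂| = h`) that sends `e` of the `A₁ ∖ A₂` vertices into free minus vertices and `f` of the
`A₂ ∖ A₁` vertices into `B₁ ∖ B₂`. Rows are plus classes `(∈ A₁, ∈ A₂)`, columns minus classes
`(∈ B₁, ∈ B₂)`. [cite: Sly2010, proof of Lemma 3.5 (the three events of (e:gt2Moment)); MosselWeitzWormald2008, §5] -/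
def epsTable (N a b g h e f : ℕ) : Bool × Bool → Bool × Bool → ℕ
  | (true, true), (false, false) => g
  | (true, false), (false, true) => a - g - e
  | (true, false), (false, false) => e
  | (false, true), (true, false) => f
  | (false, true), (false, false) => a - g - f
  | (false, false), (true, true) => h
  | (false, false), (true, false) => b - h - f
  | (false, false), (false, true) => b - h - (a - g - e)
  | (false, false), (false, false) => N - (b + b - h) - g - e - (a - g - f)
  | _, _ => 0

variable (N a b g h e f : ℕ)

/-- The `(e,f)`-table vanishes on the forbidden cells. [folklore] -/
theorem epsTable_forbidden (i k : Bool × Bool) (hik : PairForbidden i k) :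
    epsTable N a b g h e f i k = 0 := by
  obtain ⟨i1, i2⟩ := i
  obtain ⟨k1, k2⟩ := k
  unfold PairForbidden at hik
  cases i1 <;> cases i2 <;> cases k1 <;> cases k2 <;> simp_all [epsTable]

end EpsTable

section Support

variable {N a b g h : ℕ}

/-- **Every admissible table is an `(e,f)`-table**: the forbidden zeros and the row and column sums
determine the class-incidence matrix from `e = z_{(A₁∖A₂),free}` and `f = z_{(A₂∖A₁),(B₁∖B₂)}`.
[folklore] -/
theorem eq_epsTable_of_admissible (z : Bool × Bool → Bool × Bool → ℕ)
    (h0 : ∀ i k, PairForbidden i k → z i k = 0)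
    (hcol : ∀ k, ∑ i, z i k = pairSizes N b b h k) (hrow : ∀ i, ∑ k, z i k = pairSizes N a a g i) :
    z = epsTable N a b g h (z (true, false) (false, false)) (z (false, true) (true, false)) := by
  have f1 := h0 (true, true) (true, true) (by unfold PairForbidden; simp)
  have f2 := h0 (true, true) (true, false) (by unfold PairForbidden; simp)
  have f3 := h0 (true, true) (false, true) (by unfold PairForbidden; simp)
  have f4 := h0 (true, false) (true, true) (by unfold PairForbidden; simp)
  have f5 := h0 (true, false) (true, false) (by unfold PairForbidden; simp)
  have f6 := h0 (false, true) (true, true) (by unfold PairForbidden; simp)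
  have f7 := h0 (false, true) (false, true) (by unfold PairForbidden; simp)
  have r1 := hrow (true, true)
  have r2 := hrow (true, false)
  have r3 := hrow (false, true)
  have c1 := hcol (true, true)
  have c2 := hcol (true, false)
  have c3 := hcol (false, true)
  have c4 := hcol (false, false)
  simp only [sum_boolPair, pairSizes, f1, f2, f3, f4, f5, f6, f7, zero_add, add_zero]
    at r1 r2 r3 c1 c2 c3 c4
  funext i k
  obtain ⟨i1, i2⟩ := i
  obtain ⟨k1, k2⟩ := k
  cases i1 <;> cases i2 <;> cases k1 <;> cases k2 <;> simp only [epsTable] <;> omega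

/-- The `(e,f)` read off an admissible table satisfy the five cell constraints. [folklore] -/
theorem epsConstraints_of_admissible (z : Bool × Bool → Bool × Bool → ℕ)
    (h0 : ∀ i k, PairForbidden i k → z i k = 0)
    (hcol : ∀ k, ∑ i, z i k = pairSizes N b b h k) (hrow : ∀ i, ∑ k, z i k = pairSizes N a a g i) :
    z (true, false) (false, false) ≤ a - g ∧ z (false, true) (true, false) ≤ a - g ∧
      z (false, true) (true, false) ≤ b - h ∧ a - g - z (true, false) (false, false) ≤ b - h ∧
        g + z (true, false) (false, false) + (a - g - z (false, true) (true, false)) ≤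
          N - (b + b - h) := by
  have f1 := h0 (true, true) (true, true) (by unfold PairForbidden; simp)
  have f2 := h0 (true, true) (true, false) (by unfold PairForbidden; simp)
  have f3 := h0 (true, true) (false, true) (by unfold PairForbidden; simp)
  have f4 := h0 (true, false) (true, true) (by unfold PairForbidden; simp)
  have f5 := h0 (true, false) (true, false) (by unfold PairForbidden; simp)
  have f6 := h0 (false, true) (true, true) (by unfold PairForbidden; simp)
  have f7 := h0 (false, true) (false, true) (by unfold PairForbidden; simp)
  have r1 := hrow (true, true)
  have r2 := hrow (true, false)
  have r3 := hrow (false, true)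
  have c1 := hcol (true, true)
  have c2 := hcol (true, false)
  have c3 := hcol (false, true)
  have c4 := hcol (false, false)
  simp only [sum_boolPair, pairSizes, f1, f2, f3, f4, f5, f6, f7, zero_add, add_zero]
    at r1 r2 r3 c1 c2 c3 c4
  omega

/-- The `(e,f)`-tables with admissible `(e,f)` are admissible. [folklore] -/
theorem epsTable_admissible {e f : ℕ} (hga : g ≤ a) (hhb : h ≤ b) (he : e ≤ a - g) (hf : f ≤ a - g)
    (hfA : f ≤ b - h) (heA : a - g - e ≤ b - h)
    (hff : g + e + (a - g - f) ≤ N - (b + b - h)) (haN : a + a - g ≤ N) (hbN : b + b - h ≤ N) :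
    (∀ i k, PairForbidden i k → epsTable N a b g h e f i k = 0) ∧
      (∀ k, ∑ i, epsTable N a b g h e f i k = pairSizes N b b h k) ∧
        ∀ i, ∑ k, epsTable N a b g h e f i k = pairSizes N a a g i := by
  refine ⟨fun i k hik => epsTable_forbidden N a b g h e f i k hik, ?_, ?_⟩
  · rintro ⟨k1, k2⟩
    cases k1 <;> cases k2 <;> simp only [sum_boolPair, epsTable, pairSizes] <;> omega
  · rintro ⟨i1, i2⟩
    cases i1 <;> cases i2 <;> simp only [sum_boolPair, epsTable, pairSizes] <;> omega

end Support

section Reindex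

variable {N a b g h : ℕ}

/-- The admissible `(e, f)`: the five cell constraints. [folklore] -/
def epsIndex (N a b g h : ℕ) : Finset (ℕ × ℕ) :=
  ((range (a - g + 1)) ×ˢ (range (a - g + 1))).filter fun ef =>
    ef.2 ≤ b - h ∧ a - g - ef.1 ≤ b - h ∧ g + ef.1 + (a - g - ef.2) ≤ N - (b + b - h)

/-- Membership in `epsIndex`. [folklore] -/
theorem mem_epsIndex {ef : ℕ × ℕ} :
    ef ∈ epsIndex N a b g h ↔ ef.1 ≤ a - g ∧ ef.2 ≤ a - g ∧ ef.2 ≤ b - h ∧ a - g - ef.1 ≤ b - h ∧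
      g + ef.1 + (a - g - ef.2) ≤ N - (b + b - h) := by
  unfold epsIndex
  simp only [mem_filter, mem_product, mem_range, Nat.lt_succ_iff]
  tauto

/-- All cells of an admissible `(e,f)`-table are at most `N`. [folklore] -/
theorem epsTable_le (hga : g ≤ a) (hhb : h ≤ b) (haN : a + a - g ≤ N) (hbN : b + b - h ≤ N)
    {e f : ℕ} (he : e ≤ a - g) (hf : f ≤ a - g) (i k : Bool × Bool) :
    epsTable N a b g h e f i k ≤ N := by
  obtain ⟨i1, i2⟩ := i
  obtain ⟨k1, k2⟩ := k
  cases i1 <;> cases i2 <;> cases k1 <;> cases k2 <;> simp only [epsTable] <;> omega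

/-- **The two-rectangle count as a sum over `(e,f)`-tables.** [folklore] -/
theorem pairAvoidSum_eq_sum_epsIndex (hga : g ≤ a) (hhb : h ≤ b) (haN : a + a - g ≤ N)
    (hbN : b + b - h ≤ N) :
    pairAvoidSum N (pairSizes N a a g) (pairSizes N b b h) =
      ∑ ef ∈ epsIndex N a b g h,
        pairAvoidTermN (pairSizes N a a g) (pairSizes N b b h) (epsTable N a b g h ef.1 ef.2) := by
  classical
  unfold pairAvoidSum
  set p := pairSizes N a a g with hp
  set m := pairSizes N b b h with hm
  set T : (Bool × Bool → Bool × Bool → Fin (N + 1)) → ℕ :=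
    fun z => pairAvoidTermN p m fun i k => (z i k : ℕ) with hT
  -- restrict to the support
  rw [← Finset.sum_filter_ne_zero (s := (univ : Finset (Bool × Bool → Bool × Bool → Fin (N + 1))))]
  -- admissibility of a table in the support
  have hadm : ∀ z : Bool × Bool → Bool × Bool → Fin (N + 1), T z ≠ 0 →
      (∀ i k, PairForbidden i k → (z i k : ℕ) = 0) ∧ (∀ k, ∑ i, (z i k : ℕ) = m k) ∧
        ∀ i, ∑ k, (z i k : ℕ) = p i := by
    intro z hz
    by_contra hc
    apply hz
    simp only [hT, pairAvoidTermN]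
    rw [if_neg]
    exact hc
  refine Finset.sum_bij (fun z _ => (((z (true, false) (false, false) : ℕ)), ((z (false, true) (true, false) : ℕ))))
    ?_ ?_ ?_ ?_
  · -- into `epsIndex`
    intro z hz
    rw [mem_filter] at hz
    obtain ⟨h0, hcol, hrow⟩ := hadm z hz.2
    have hc := epsConstraints_of_admissible (N := N) (a := a) (b := b) (g := g) (h := h) _ h0 hcol hrow
    rw [mem_epsIndex]
    exact ⟨hc.1, hc.2.1, hc.2.2.1, hc.2.2.2.1, hc.2.2.2.2⟩
  · -- injective
    intro z₁ hz₁ z₂ hz₂ heq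
    rw [mem_filter] at hz₁ hz₂
    obtain ⟨h0₁, hcol₁, hrow₁⟩ := hadm z₁ hz₁.2
    obtain ⟨h0₂, hcol₂, hrow₂⟩ := hadm z₂ hz₂.2
    have e₁ := eq_epsTable_of_admissible _ h0₁ hcol₁ hrow₁
    have e₂ := eq_epsTable_of_admissible _ h0₂ hcol₂ hrow₂
    simp only [Prod.mk.injEq] at heq
    rw [heq.1, heq.2, ← e₂] at e₁
    funext i k
    exact Fin.ext (congrFun (congrFun e₁ i) k)
  · -- surjective
    rintro ⟨e, f⟩ hef
    rw [mem_epsIndex] at hef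
    obtain ⟨he, hf, hfA, heA, hff⟩ := hef
    let z : Bool × Bool → Bool × Bool → Fin (N + 1) :=
      fun i k => ⟨epsTable N a b g h e f i k, Nat.lt_succ_of_le (epsTable_le hga hhb haN hbN he hf i k)⟩
    have hz : (fun i k => (z i k : ℕ)) = epsTable N a b g h e f := rfl
    obtain ⟨h0, hcol, hrow⟩ := epsTable_admissible (N := N) hga hhb he hf hfA heA hff haN hbN
    refine ⟨z, ?_, ?_⟩
    · rw [mem_filter]
      refine ⟨mem_univ _, ?_⟩
      change pairAvoidTermN p m (fun i k => (z i k : ℕ)) ≠ 0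
      rw [hz, pairAvoidTermN, if_pos ⟨h0, hcol, hrow⟩]
      exact Nat.ne_of_gt (Nat.mul_pos (Finset.prod_pos fun i _ => Nat.multinomial_pos _ _)
        (Finset.prod_pos fun k _ => Nat.factorial_pos _))
    · simp [z, epsTable]
  · -- values
    intro z hz
    rw [mem_filter] at hz
    obtain ⟨h0, hcol, hrow⟩ := hadm z hz.2
    have e₁ := eq_epsTable_of_admissible _ h0 hcol hrow
    change pairAvoidTermN p m (fun i k => (z i k : ℕ)) = _
    rw [e₁]

end Reindex

section Evaluate

variable {N a b g h : ℕ}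

/-- The multinomial coefficient as a quotient of factorials in `ℚ`. [folklore] -/
theorem multinomial_cast {ι : Type*} (s : Finset ι) (f : ι → ℕ) :
    (Nat.multinomial s f : ℚ) = ((∑ i ∈ s, f i).factorial : ℚ) / ∏ i ∈ s, ((f i).factorial : ℚ) := by
  rw [eq_div_iff (Finset.prod_ne_zero_iff.mpr fun i _ => by positivity)]
  have h := Nat.multinomial_spec s f
  rw [mul_comm] at h
  exact_mod_cast h

/-- The `f`-independent weight of the `(e,f)`-term. [folklore] -/
noncomputable def epsW (N a b g h e : ℕ) : ℚ :=
  ((a - g).choose e : ℚ) *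
    ((N - (a + a - g)).factorial * (b - h).factorial * (b - h).factorial *
        (N - (b + b - h)).factorial : ℚ) /
      ((b - h - (a - g - e)).factorial * (N - b - g - e - (a - g)).factorial : ℚ)

/-- **The value of an `(e,f)`-term**: `C(P,f) C(T-P, A-f) · W(e)` with `P = a-g`, `A = b-h`,
`T = N-b-g-e`. [folklore] -/
theorem pairAvoidTermN_epsTable (hga : g ≤ a) (hhb : h ≤ b) (haN : a + a - g ≤ N)
    (hbN : b + b - h ≤ N) {e f : ℕ} (hef : (e, f) ∈ epsIndex N a b g h) :
    (pairAvoidTermN (pairSizes N a a g) (pairSizes N b b h) (epsTable N a b g h e f) : ℚ) =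
      (((a - g).choose f * (N - b - g - e - (a - g)).choose (b - h - f) : ℕ) : ℚ) *
        epsW N a b g h e := by
  rw [mem_epsIndex] at hef
  obtain ⟨he, hf, hfA, heA, hff⟩ := hef
  dsimp only at he hf hfA heA hff
  obtain ⟨h0, hcol, hrow⟩ := epsTable_admissible (N := N) hga hhb he hf hfA heA hff haN hbN
  rw [pairAvoidTermN, if_pos ⟨h0, hcol, hrow⟩]
  push_cast
  rw [prod_boolPair, prod_boolPair]
  simp only [multinomial_cast, hrow, prod_boolPair]
  simp only [pairSizes, epsTable, Nat.factorial_zero, Nat.cast_one, one_mul, mul_one]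
  -- the binomials on the right
  have hx : N - b - g - e - (a - g) - (b - h - f) = N - (b + b - h) - g - e - (a - g - f) := by omega
  have hk : b - h - f ≤ N - b - g - e - (a - g) := by omega
  rw [epsW, Nat.cast_choose ℚ he, Nat.cast_choose ℚ hf, Nat.cast_choose ℚ hk, hx]
  field_simp

/-- **Vandermonde for the inner `f`-sum.** [folklore] -/
theorem sum_inner_vandermonde (hga : g ≤ a) {e : ℕ} (he : e ≤ a - g) (heA : a - g - e ≤ b - h)
    (hgF : g + e ≤ N - (b + b - h)) (hPT : a - g ≤ N - b - g - e) :
    ∑ f ∈ range (a - g + 1),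
        (if f ≤ b - h ∧ a - g - e ≤ b - h ∧ g + e + (a - g - f) ≤ N - (b + b - h) then
          (((a - g).choose f * (N - b - g - e - (a - g)).choose (b - h - f) : ℕ) : ℚ) else 0) =
      ((N - b - g - e).choose (b - h) : ℚ) := by
  rw [← Finset.sum_filter]
  have hV := Nat.add_choose_eq (a - g) (N - b - g - e - (a - g)) (b - h)
  rw [Nat.add_sub_cancel' hPT, Finset.Nat.sum_antidiagonal_eq_sum_range_succ_mk] at hV
  rw [hV]
  push_cast
  apply Finset.sum_subset
  · intro f hf
    rw [mem_filter, mem_range] at hf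
    rw [mem_range]
    omega
  · intro f hf hnot
    rw [mem_range] at hf
    rw [mem_filter, mem_range, not_and] at hnot
    by_cases hfP : f < a - g + 1
    · have h3 : ¬(g + e + (a - g - f) ≤ N - (b + b - h)) := by
        intro h3; exact hnot hfP ⟨by omega, heA, h3⟩
      have : (N - b - g - e - (a - g)).choose (b - h - f) = 0 := Nat.choose_eq_zero_of_lt (by omega)
      simp [this]
    · have : (a - g).choose f = 0 := Nat.choose_eq_zero_of_lt (by omega)
      simp [this]

/-- **The weight times the Vandermonde binomial is Sly's term.** [folklore] -/
theorem epsW_mul_choose (hga : g ≤ a) (hhb : h ≤ b) (hbN : b + b - h ≤ N)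
    {e : ℕ} (he : e ≤ a - g) (heA : a - g - e ≤ b - h) (hgF : g + e ≤ N - (b + b - h))
    (hPT : a - g ≤ N - b - g - e) :
    epsW N a b g h e * ((N - b - g - e).choose (b - h) : ℚ) =
      ((g.factorial * (a - g).factorial * (a - g).factorial * (N - (a + a - g)).factorial *
          (N - (b + b - h)).choose g : ℕ) : ℚ) *
        (((N - (b + b - h) - g).choose e * (b - h).choose (a - g - e) *
          (N - b - g - e).choose (a - g) : ℕ) : ℚ) := by
  have hg : g ≤ N - (b + b - h) := by omega
  have heF : e ≤ N - (b + b - h) - g := by omega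
  have hAT : b - h ≤ N - b - g - e := by omega
  have hTA : N - b - g - e - (b - h) = N - (b + b - h) - g - e := by omega
  have hAP : b - h - (a - g - e) = b - h - (a - g - e) := rfl
  rw [epsW]
  push_cast
  rw [Nat.cast_choose ℚ he, Nat.cast_choose ℚ hAT, Nat.cast_choose ℚ hg, Nat.cast_choose ℚ heF,
    Nat.cast_choose ℚ heA, Nat.cast_choose ℚ hPT, hTA]
  field_simp

/-- **The ε-form of the two-rectangle permutation count** (Sly's inner sum of (e:gt2Moment)):
`#{π ∈ S_N : π(A₁) ∩ B₁ = ∅, π(A₂) ∩ B₂ = ∅} = g! (P!)² R! C(F₀, g) Σ_e C(F₀-g, e) C(A, P-e) C(N-b-g-e, P)`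
with `P = a-g`, `A = b-h`, `R = N-2a+g`, `F₀ = N-2b+h` (the common occupied plus vertices go to free
minus vertices, then `e` of the `σ`-only plus vertices go to free minus vertices and the rest to
`τ`-only minus vertices, then the `τ`-only plus vertices go anywhere allowed, then the rest).
[cite: Sly2010, proof of Lemma 3.5, eq. (e:gt2Moment); MosselWeitzWormald2008, §5 (the three events of `Ψ₂`)] -/
theorem pairAvoidSum_pairSizes_eq (hga : g ≤ a) (hhb : h ≤ b) (haN : a + a - g ≤ N)
    (hbN : b + b - h ≤ N) :
    (pairAvoidSum N (pairSizes N a a g) (pairSizes N b b h) : ℚ) =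
      ((g.factorial * (a - g).factorial * (a - g).factorial * (N - (a + a - g)).factorial *
          (N - (b + b - h)).choose g : ℕ) : ℚ) *
        ∑ e ∈ range (a - g + 1),
          (((N - (b + b - h) - g).choose e * (b - h).choose (a - g - e) *
            (N - b - g - e).choose (a - g) : ℕ) : ℚ) := by
  rw [pairAvoidSum_eq_sum_epsIndex hga hhb haN hbN]
  push_cast
  -- evaluate the terms
  rw [Finset.sum_congr rfl fun ef hef =>
    pairAvoidTermN_epsTable (e := ef.1) (f := ef.2) hga hhb haN hbN hef]
  -- split the double sum
  unfold epsIndex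
  rw [Finset.sum_filter, Finset.sum_product, Finset.mul_sum]
  refine Finset.sum_congr rfl fun e he => ?_
  rw [mem_range, Nat.lt_succ_iff] at he
  by_cases hcond : a - g - e ≤ b - h ∧ g + e ≤ N - (b + b - h) ∧ a - g ≤ N - b - g - e
  · obtain ⟨heA, hgF, hPT⟩ := hcond
    have hV := sum_inner_vandermonde (N := N) hga he heA hgF hPT
    have hW := epsW_mul_choose hga hhb hbN he heA hgF hPT
    push_cast at hW hV ⊢
    rw [← hW, ← hV, Finset.mul_sum]
    refine Finset.sum_congr rfl fun f _ => ?_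
    split_ifs <;> ring
  · -- both sides vanish
    have hL : ∀ f ∈ range (a - g + 1),
        (if f ≤ b - h ∧ a - g - e ≤ b - h ∧ g + e + (a - g - f) ≤ N - (b + b - h) then
          (((a - g).choose f * (N - b - g - e - (a - g)).choose (b - h - f) : ℕ) : ℚ) *
            epsW N a b g h e else 0) = 0 := by
      intro f hf
      rw [if_neg]
      rintro ⟨h1, h2, h3⟩
      apply hcond
      refine ⟨h2, by omega, by omega⟩
    rw [Finset.sum_congr rfl hL, Finset.sum_const_zero]
    rw [not_and_or, not_and_or] at hcond
    rcases hcond with h1 | h2 | h3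
    · rw [Nat.choose_eq_zero_of_lt (n := b - h) (by omega)]; simp
    · by_cases hg0 : g ≤ N - (b + b - h)
      · rw [Nat.choose_eq_zero_of_lt (n := N - (b + b - h) - g) (by omega)]; simp
      · rw [Nat.choose_eq_zero_of_lt (n := N - (b + b - h)) (k := g) (by omega)]; simp
    · rw [Nat.choose_eq_zero_of_lt (n := N - b - g - e) (k := a - g) (by omega)]; simp

end Evaluate

end Literature.Computability.Complexity
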